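/-
Copyright: the b2b-balaban cell (near-miss cell 7), T⁴-continuum fan-out, lineage t4-ne7b-p3 (node U5c LARGE-DEVIATION
member P3).  Released under the licence of the surrounding project.
-/
import Summits.QuantumFields.BalabanUV.T4Continuum.Support.SpaceTimeRealised

/-!
# Space-time Peierls ∕ Cramér route for NE7b — A REALISED LINEAGE IN THE INDEX MODEL, II (skeleton row ST5-instance):
# THE CELL BINDER — cells of one structure-step, and of the whole history tree, under the typed drop control

Summits-side support leaf of the T⁴-continuum cell (rung (B)+1 on a FINITE torus only; NOT infinite volume, NOT the
mass gap, NOT the Clay statement; NOT a proof of the spine estimate NE7b).  Lineage `t4-ne7b-p3` (generation 2), node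
U5c, skeleton `t4/skeletons/NE7b-t4-ne7b-p3.md` leaf A2b (volume side) ∕ A3b, row ST5.  [folklore] finite combinatorics
and real arithmetic over `SpaceTimeRealised` (this lineage), the row's shared genealogy carrier
`T4PersistenceDictionary.Gen` (lineage t4-ne7b-p1) and the cell's kernel-checked index model of the operation `S`
(`B16SProfile`: `Siter_subset_biUnion_box`, `two_pow_le_Qprod`, `card_box`, `DropCtl`, `ratio`; `TreeLength.card_le_treeLen`)
— imported BY NAME, nothing modified; nothing is quoted from print and nothing printed is asserted; no `[cite:]` tag.

WHAT.  Companion of `SpaceTimeRealised` (pieces, `dom`, `skel`, `SkelOK`, `treeLen_skel_le : treeLen (skel V n) ≤ DQ V n`).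
* §1 under the drop control of the typed flow (`DropCtl σ m`, block size `L ≥ 4`, ratios `ratio L σ`): exact
  coarsening dominates the decay weight, `1 ∕ Qs s n ≤ 2·2^{−(n−s)}` (`inv_Qs_le`, from `B16SProfile.two_pow_le_Qprod`),
  hence `DQ ≤ 2·Dfun` (`DQ_le_two_Dfun`); the S-iterates lie in radius-31 boxes around the covers
  (`B16SProfile.Siter_subset_biUnion_box`), so `#dom V n ≤ 63^d·#skel V n` (`card_dom_le_card_skel`) and, with
  `TreeLength.card_le_treeLen`, **`card_dom_le`**: `#dom V n ≤ 8·126^d · Dfun V n + 126^d` at every step of the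
  structure's segment up to the horizon;
* §2 **`treeCells_le`**: the realised cell counts summed over the structure-steps of the history tree
  (`treeCells`, the `treeD`∕`treeSteps`∕`T4PrintedShapeBanking.treeCost` enumeration) satisfy
  `treeCells V t ≤ 8·126^d · treeD V t + 126^d · treeSteps V t` for every cut `t ≤ m + 1` — the `hvol` binder of
  `SpaceTimeVolume.volumeAccounting_ledgerOfGen` (`cA = 8·126^d`, `cB = 126^d`) for a contour whose cells are the
  structure-steps' realised domains (`#𝒦 ≤ treeCells`, the occupancy reading, displayed in `SpaceTimeAssembly`).
Nothing of Bałaban's is asserted: the identification of his domains with `dom`, the connectedness of merged skeletons,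
the class ∕ connector bounds (`SkelOK`) and `DropCtl` stay hypotheses.

HONEST DEPENDENCY (cell, verbatim): continuum YM on T⁴ ⇐ BetaPertH ∧ nine spine estimates (0/9 proved); BetaPertH ⇐
(D1) ∧ (D4) ∧ CAP+tail; G-an2-4 gates asym, D1 and NE2/3/4.  This file changes none of it.
-/

open Finset

namespace Summit.QuantumFields.BalabanUV.T4Continuum.SpaceTimePeierls

open Literature.MathematicalPhysics.QuantumFieldTheory.Balaban1983to89
open Literature.MathematicalPhysics.QuantumFieldTheory.Balaban1983to89.B13ScaleTransfer
open Literature.MathematicalPhysics.QuantumFieldTheory.Balaban1983to89.TreeLength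
open Literature.MathematicalPhysics.QuantumFieldTheory.Balaban1983to89.B16SProfile
open T4PersistenceDictionary

noncomputable section

/-! ## §0 Realised domains: the S-iterates of the pieces -/

section Domains

variable {d : ℕ}

/-- **THE S-ITERATE** at step `n` of a piece created at step `s`: `S^{n−s}(Z)` along the ratios from `s` on. [folklore] -/
def iterAt (q : ℕ → ℕ) (s n : ℕ) (Z : Finset (Pt d)) : Finset (Pt d) := Siter (fun l => q (s + l)) (n - s) Z

/-- the operation `S` of nothing is nothing [folklore] -/
theorem Sop_empty (q : ℕ) : Sop q (∅ : Finset (Pt d)) = ∅ := by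
  unfold Sop
  rw [show closureIdx q (∅ : Finset (Pt d)) = ∅ by simp [closureIdx]]
  exact Function.iterate_fixed (by simp [collar]) 10

/-- the S-iterate of nothing is nothing [folklore] -/
theorem Siter_empty (q : ℕ → ℕ) : ∀ i, Siter q i (∅ : Finset (Pt d)) = ∅
  | 0 => rfl
  | i + 1 => by rw [Siter_succ, Siter_empty q i, Sop_empty]

/-- the S-iterate of an empty piece is empty [folklore] -/
@[simp] theorem iterAt_empty (q : ℕ → ℕ) (s n : ℕ) : iterAt q s n (∅ : Finset (Pt d)) = ∅ := Siter_empty _ _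

variable {ε : Type*} [DecidableEq ε]

/-- **THE REALISED DOMAIN** of the structure described by `G` at step `n`: the union of the S-iterates of its pieces —
the S-evolution of the merged domains, since `S` distributes over unions. [folklore] -/
def dom (q : ℕ → ℕ) (step : ε → ℕ) (piece : ε → Finset (Pt d)) (G : Gen ε) (n : ℕ) : Finset (Pt d) :=
  G.events.biUnion fun e => iterAt q (step e) n (piece e)

variable {q : ℕ → ℕ} {step : ε → ℕ} {piece : ε → Finset (Pt d)}

/-- the realised domain of a renewed component is the old one [folklore] -/
theorem dom_renew (G : Gen ε) {e : ε} (h : ℕ) (he : piece e = ∅) (n : ℕ) :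
    dom q step piece (Gen.renew G e h) n = dom q step piece G n := by
  unfold dom
  rw [Gen.events_renew, biUnion_insert, he, iterAt_empty, empty_union]

/-- the realised domain of a merged component: the connector's iterate ∪ the partners' domains [folklore] -/
theorem dom_merge (X Y : Gen ε) (e : ε) (n : ℕ) :
    dom q step piece (Gen.merge X Y e) n =
      iterAt q (step e) n (piece e) ∪ (dom q step piece X n ∪ dom q step piece Y n) := by
  unfold dom
  rw [Gen.events_merge, biUnion_insert, biUnion_union']

end Domains

/-! ## §1 Under the drop control: boxes of radius 31, and the cells of one structure-step -/

section Cells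

variable {d : ℕ} {ε : Type*} [DecidableEq ε] {step : ε → ℕ} {piece : ε → Finset (Pt d)} {fat : ε → ℕ} {dC : ℝ}
  {L : ℕ} {σ : ℕ → ℕ} {m : ℕ}

omit [DecidableEq ε] in
/-- the exact profile is nonnegative [folklore] -/
theorem DQ_nonneg {q : ℕ → ℕ} (hdC : 0 ≤ dC) : ∀ (G : Gen ε) (n : ℕ), 0 ≤ DQ q fat step dC G n
  | Gen.born b j, n => by simp only [DQ]; positivity
  | Gen.renew G _ _, n => by simp only [DQ]; exact DQ_nonneg hdC G n
  | Gen.merge X Y e, n => by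
      simp only [DQ]
      exact add_nonneg (add_nonneg (DQ_nonneg hdC X n) (DQ_nonneg hdC Y n)) (by positivity)

/-- the shifted ratio sequence of the flow is the ratio sequence of the shifted exponents [folklore] -/
theorem ratio_shift (L : ℕ) (σ : ℕ → ℕ) (s : ℕ) : (fun l => ratio L σ (s + l)) = ratio L (fun l => σ (s + l)) := by
  funext l
  rfl

/-- drop control is inherited by the shifted exponents on the remaining horizon [folklore] -/
theorem dropCtl_shift (h : DropCtl σ m) (s : ℕ) : DropCtl (fun l => σ (s + l)) (m - s) := by
  intro i k hik hk
  have := h (s + i) (s + k) (by omega) (by omega)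
  rwa [show s + k - (s + i) = k - i by omega] at this

/-- **EXACT COARSENING DOMINATES THE DECAY WEIGHT**: `1 ∕ Qs s n ≤ 2·2^{−(n−s)}` for `s ≤ n ≤ m` (`2^i ≤ Q_i` for
`i ≥ 2`, `B16SProfile.two_pow_le_Qprod`; `Q ≥ 1` for the first two steps). [folklore] -/
theorem inv_Qs_le (hL : 4 ≤ L) (h : DropCtl σ m) {s n : ℕ} (hs : s ≤ n) (hn : n ≤ m) :
    (1 : ℝ) / Qs (ratio L σ) s n ≤ 2 * decay s n := by
  have hL0 : 0 < L := by omega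
  have hQpos : 0 < Qs (ratio L σ) s n := Qs_pos (ratio_pos hL0 σ) s n
  have hQ : (0 : ℝ) < Qs (ratio L σ) s n := by exact_mod_cast hQpos
  unfold decay
  rw [if_pos hs]
  rcases Nat.lt_or_ge (n - s) 2 with hi | hi
  · -- at most one step: `Q ≥ 1` and `2·(1/2)^i ≥ 1`
    have h1 : (1 : ℝ) / Qs (ratio L σ) s n ≤ 1 := by
      rw [div_le_one hQ]; exact_mod_cast hQpos
    have h2 : (1 : ℝ) ≤ 2 * (1 / 2 : ℝ) ^ (n - s) := by
      interval_cases (n - s) <;> norm_num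
    exact h1.trans h2
  · have hQ2 : 2 ^ (n - s) ≤ Qs (ratio L σ) s n := by
      unfold Qs
      rw [ratio_shift]
      exact two_pow_le_Qprod hL (dropCtl_shift h s) hi (by omega)
    have hQ2' : ((2 : ℝ) ^ (n - s)) ≤ Qs (ratio L σ) s n := by exact_mod_cast hQ2
    have hp : (0 : ℝ) < 2 ^ (n - s) := by positivity
    calc (1 : ℝ) / Qs (ratio L σ) s n ≤ 1 / 2 ^ (n - s) := one_div_le_one_div_of_le hp hQ2'
      _ = (1 / 2 : ℝ) ^ (n - s) := by rw [one_div_pow]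
      _ ≤ 2 * (1 / 2 : ℝ) ^ (n - s) := by linarith [pow_nonneg (by norm_num : (0:ℝ) ≤ 1 / 2) (n - s)]

/-- the exact profile is at most twice the decaying profile, for structures all of whose events have happened by the
step `n ≤ m` [folklore] -/
theorem DQ_le_two_Dfun (hL : 4 ≤ L) (h : DropCtl σ m) (hdC : 0 ≤ dC) :
    ∀ {G : Gen ε}, SkelOK (ratio L σ) step piece fat dC G → ∀ {n : ℕ}, (∀ e ∈ G.events, step e ≤ n) → n ≤ m →
      DQ (ratio L σ) fat step dC G n ≤ 2 * Dfun fat step dC G n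
  | Gen.born b j, hok, n, hev, hn => by
      obtain ⟨hb, -⟩ := hok
      have hj : j ≤ n := by have := hev b (by simp); rw [hb] at this; exact this
      simp only [DQ, Dfun]
      have := inv_Qs_le hL h hj hn
      have h0 : (0 : ℝ) ≤ fat b := Nat.cast_nonneg _
      calc (fat b : ℝ) / Qs (ratio L σ) j n = fat b * (1 / Qs (ratio L σ) j n) := by ring
        _ ≤ fat b * (2 * decay j n) := mul_le_mul_of_nonneg_left this h0
        _ = 2 * (fat b * decay j n) := by ring
  | Gen.renew G e hh, hok, n, hev, hn => by
      obtain ⟨hG, -⟩ := hok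
      simp only [DQ, Dfun]
      exact DQ_le_two_Dfun hL h hdC hG (fun e' he' => hev e' (by simp [he'])) hn
  | Gen.merge X Y e, hok, n, hev, hn => by
      obtain ⟨hX, hY, -⟩ := hok
      have he : step e ≤ n := hev e (by simp)
      have hXb := DQ_le_two_Dfun hL h hdC hX (fun e' he' => hev e' (by simp [he'])) hn
      have hYb := DQ_le_two_Dfun hL h hdC hY (fun e' he' => hev e' (by simp [he'])) hn
      have hc := inv_Qs_le hL h he hn
      simp only [DQ, Dfun]
      have : dC / Qs (ratio L σ) (step e) n ≤ 2 * (dC * decay (step e) n) := by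
        calc dC / Qs (ratio L σ) (step e) n = dC * (1 / Qs (ratio L σ) (step e) n) := by ring
          _ ≤ dC * (2 * decay (step e) n) := mul_le_mul_of_nonneg_left hc hdC
          _ = 2 * (dC * decay (step e) n) := by ring
      linarith

/-- **THE S-ITERATES LIE IN RADIUS-31 BOXES AROUND THE SKELETON**, so `#dom V n ≤ 63^d · #skel V n`
(`B16SProfile.Siter_subset_biUnion_box` per piece, `card_box`). [folklore] -/
theorem card_dom_le_card_skel (hL : 3 ≤ L) (h : DropCtl σ m) (G : Gen ε) {n : ℕ}
    (hev : ∀ e ∈ G.events, step e ≤ n) (hn : n ≤ m) :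
    (dom (ratio L σ) step piece G n).card ≤ 63 ^ d * (skel (ratio L σ) step piece G n).card := by
  classical
  have hsub : dom (ratio L σ) step piece G n ⊆ (skel (ratio L σ) step piece G n).biUnion fun c => box c 31 := by
    unfold dom skel
    rw [Finset.biUnion_biUnion]
    refine Finset.biUnion_mono fun e he => ?_
    have hse := hev e he
    unfold iterAt coverAt Qs
    rw [ratio_shift]
    exact Siter_subset_biUnion_box hL (dropCtl_shift h (step e)) (piece e) (by omega)
  calc (dom (ratio L σ) step piece G n).card
      ≤ ((skel (ratio L σ) step piece G n).biUnion fun c => box c 31).card := card_le_card hsub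
    _ ≤ ∑ c ∈ skel (ratio L σ) step piece G n, (box c 31).card := card_biUnion_le
    _ = ∑ _c ∈ skel (ratio L σ) step piece G n, 63 ^ d := by simp [card_box]
    _ = 63 ^ d * (skel (ratio L σ) step piece G n).card := by rw [sum_const, smul_eq_mul, mul_comm]

/-- **THE CELLS OF ONE STRUCTURE-STEP**: for a realised genealogy under the drop control (`L ≥ 4`), at every step `n`
of the structure's segment (`step top ≤ n ≤ m`),
`#dom V n ≤ 8·126^d · Dfun V n + 126^d` — the displayed cell binder of the CONTOUR route with `cA = 8·126^d`,
`cB = 126^d`, per structure-step, PROVED on the index model. [folklore] -/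
theorem card_dom_le (hL : 4 ≤ L) (h : DropCtl σ m) (hdC : 0 ≤ dC) {G : Gen ε}
    (hok : SkelOK (ratio L σ) step piece fat dC G) {n : ℕ} (hn : step G.top ≤ n) (hnm : n ≤ m) :
    ((dom (ratio L σ) step piece G n).card : ℝ) ≤
      8 * 126 ^ d * Dfun fat step dC G n + 126 ^ d := by
  have hL0 : 0 < L := by omega
  have hev : ∀ e ∈ G.events, step e ≤ n := fun e he => (step_top hok e he).trans hn
  obtain ⟨hne, hfc, ht⟩ := treeLen_skel_le (ratio_pos hL0 σ) hdC hok hn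
  have h1 : ((dom (ratio L σ) step piece G n).card : ℝ) ≤ 63 ^ d * (skel (ratio L σ) step piece G n).card := by
    exact_mod_cast card_dom_le_card_skel (by omega) h G hev hnm
  have h2 := card_le_treeLen hne hfc
  have h3 := DQ_le_two_Dfun hL h hdC hok hev hnm
  have h63 : (0 : ℝ) ≤ 63 ^ d := by positivity
  have h126 : (63 : ℝ) ^ d * 2 ^ d = 126 ^ d := by rw [← mul_pow]; norm_num
  calc ((dom (ratio L σ) step piece G n).card : ℝ)
      ≤ 63 ^ d * (skel (ratio L σ) step piece G n).card := h1
    _ ≤ 63 ^ d * (2 ^ d * (4 * treeLen (skel (ratio L σ) step piece G n) + 1)) :=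
        mul_le_mul_of_nonneg_left h2 h63
    _ ≤ 63 ^ d * (2 ^ d * (4 * (2 * Dfun fat step dC G n) + 1)) := by
        gcongr
        exact ht.trans h3
    _ = 8 * 126 ^ d * Dfun fat step dC G n + 126 ^ d := by rw [← h126]; ring

end Cells

/-! ## §2 Summed over the structure-steps: the cell binder of the contour -/

section Tree

variable {d : ℕ} {ε : Type*} [DecidableEq ε]

/-- **THE CELLS OF THE HISTORY TREE** up to the cut `t`: the realised domains' cell counts summed over the
structure-steps (the enumeration of `treeSteps`∕`treeD`∕`T4PrintedShapeBanking.treeCost`). [folklore] -/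
def treeCells (q : ℕ → ℕ) (step : ε → ℕ) (piece : ε → Finset (Pt d)) : Gen ε → ℕ → ℝ
  | Gen.born b j, t => ∑ n ∈ Ico j t, ((dom q step piece (Gen.born b j) n).card : ℝ)
  | Gen.renew G e h, t => treeCells q step piece G (min (h + 1) t) +
      ∑ n ∈ Ico (h + 1) t, ((dom q step piece (Gen.renew G e h) n).card : ℝ)
  | Gen.merge X Y e, t => treeCells q step piece X (min (step e) t) + treeCells q step piece Y (min (step e) t) +
      ∑ n ∈ Ico (step e) t, ((dom q step piece (Gen.merge X Y e) n).card : ℝ)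

variable {step : ε → ℕ} {piece : ε → Finset (Pt d)} {fat : ε → ℕ} {dC : ℝ} {L : ℕ} {σ : ℕ → ℕ} {m : ℕ}

/-- **THE CELL BINDER OF THE CONTOUR, PROVED ON THE INDEX MODEL**: for a realised genealogy under the drop control
(`L ≥ 4`, `DropCtl σ m`) and a cut `t ≤ m + 1`,
`treeCells V t ≤ 8·126^d · treeD V t + 126^d · treeSteps V t` — the hypothesis `hvol` of
`SpaceTimeVolume.volumeAccounting_ledgerOfGen` with `cA = 8·126^d`, `cB = 126^d`, for a contour whose cells are the
structure-steps' realised domains. [folklore] -/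
theorem treeCells_le (hL : 4 ≤ L) (h : DropCtl σ m) (hdC : 0 ≤ dC) :
    ∀ {G : Gen ε}, SkelOK (ratio L σ) step piece fat dC G → ∀ {t : ℕ}, t ≤ m + 1 →
      treeCells (ratio L σ) step piece G t ≤
        8 * 126 ^ d * treeD fat step dC G t + 126 ^ d * treeSteps step G t
  | Gen.born b j, hok, t, ht => by
      have hb : step b = j := hok.1
      simp only [treeCells, treeD, treeSteps]
      rw [mul_sum]
      have key : ∀ n ∈ Ico j t, ((dom (ratio L σ) step piece (Gen.born b j) n).card : ℝ) ≤
          8 * 126 ^ d * Dfun fat step dC (Gen.born b j) n + 126 ^ d := fun n hn => by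
        rw [mem_Ico] at hn
        exact card_dom_le hL h hdC hok (by rw [Gen.top_born, hb]; exact hn.1) (by omega)
      calc ∑ n ∈ Ico j t, ((dom (ratio L σ) step piece (Gen.born b j) n).card : ℝ)
          ≤ ∑ n ∈ Ico j t, (8 * 126 ^ d * Dfun fat step dC (Gen.born b j) n + 126 ^ d) := sum_le_sum key
        _ = ∑ n ∈ Ico j t, 8 * 126 ^ d * Dfun fat step dC (Gen.born b j) n + 126 ^ d * ((t - j : ℕ) : ℝ) := by
            rw [sum_add_distrib, sum_const, Nat.card_Ico, nsmul_eq_mul]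
            ring
  | Gen.renew G e hh, hok, t, ht => by
      have hok' := hok
      obtain ⟨hG, hpe, hse, -⟩ := hok'
      have IH := treeCells_le hL h hdC hG (t := min (hh + 1) t) ((min_le_right _ _).trans ht)
      simp only [treeCells, treeD, treeSteps]
      have key : ∀ n ∈ Ico (hh + 1) t, ((dom (ratio L σ) step piece (Gen.renew G e hh) n).card : ℝ) ≤
          8 * 126 ^ d * Dfun fat step dC (Gen.renew G e hh) n + 126 ^ d := fun n hn => by
        rw [mem_Ico] at hn
        exact card_dom_le hL h hdC hok (by rw [Gen.top_renew, hse]; exact hn.1) (by omega)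
      have hs := sum_le_sum key
      rw [sum_add_distrib, sum_const, Nat.card_Ico, nsmul_eq_mul, ← mul_sum] at hs
      push_cast
      nlinarith [hs, IH]
  | Gen.merge X Y e, hok, t, ht => by
      have hok' := hok
      obtain ⟨hX, hY, -⟩ := hok'
      have IHX := treeCells_le hL h hdC hX (t := min (step e) t) ((min_le_right _ _).trans ht)
      have IHY := treeCells_le hL h hdC hY (t := min (step e) t) ((min_le_right _ _).trans ht)
      simp only [treeCells, treeD, treeSteps]
      have key : ∀ n ∈ Ico (step e) t, ((dom (ratio L σ) step piece (Gen.merge X Y e) n).card : ℝ) ≤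
          8 * 126 ^ d * Dfun fat step dC (Gen.merge X Y e) n + 126 ^ d := fun n hn => by
        rw [mem_Ico] at hn
        exact card_dom_le hL h hdC hok (by rw [Gen.top_merge]; exact hn.1) (by omega)
      have hs := sum_le_sum key
      rw [sum_add_distrib, sum_const, Nat.card_Ico, nsmul_eq_mul, ← mul_sum] at hs
      push_cast
      nlinarith [hs, IHX, IHY]

end Tree

end

end Summit.QuantumFields.BalabanUV.T4Continuum.SpaceTimePeierls
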